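import Summits.QuantumFields.YangMills.Theorems.BalabanUVNodesRateCarriersOfRecord11
import Summits.QuantumFields.YangMills.Theorems.BalabanUVNodesN22AtRecordTowerKeyed

/-!
# BalabanUVNodes ∕ node N22 = NE9 AT THE RATE-RECORD HOME `YMDAG.UVSplit.RRec₁₁ 𝔯` (Stage 11, datum-keyed): the K4-internal edge N18 → N22 BY NAME —
# `S_N18 (RRec₁₁ 𝔯) → S_N22 (RRec₁₁ 𝔯)` for every rate reading whose node-U3 objects are a TOWER reading carrying (P) and ONE regularity letter per level
# ((R₂) second differences ∕ (A′) derivative letter ∕ (A) sup letter), the letter block's `C₉, ω` being the slot's; and N22's half of K4 at the home REDUCED to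
# «NE9 at every level» (fading memory BY NAME from the letter signs) — plan word (W2) at ₁₁; count-neutral

Cell `pub-ymgap`, HUMAN RULING D-0062 (Track A), seat `pub-ymgap-dag-n22-e` (R134 strategy s2 = by-name knit at the ₁₁ record; the (T-RATE) pen of dag-lead's WORDS-99∕101),
generation 0, module 3.  THEOREMS ONLY (0 `def`); imports this seat's layer B of the rate-record home (`BalabanUVNodesRateCarriersOfRecord11`: `RRec₁₁`, `rateCarriersOfRecord₁₁`,
`u3OfRecord₁₁`, `towerData₁₁`, `u3OfRecord₁₁_objects`, the `RRec₁₁.*` faces, `s_N22_rRec₁₁_iff`) and its tower-keyed edge (`BalabanUVNodesN22AtRecordTowerKeyed`, p452282: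
`s_N22_of_s_N18_towerKeyed{,_strip,_analytic}`).  `--supports stmt-QuantumFields-19676` (K3 `SpineGivenEndpointR11`).

WHAT.
* §1 `s_N22_rRec₁₁_of_ne9` — under the letter signs of the reading, N22's K4 stub at the home IS «NE9 at every run length of every datum's canonical object tower» (the
  fading-memory half is the letter block's shape, `fadingMemory_u3OfRecord₁₁`); the θ-FORM a consumer proves (`∀` admissible θ with provisos) suffices.
* §2 THE EDGE AT THE HOME, (R₂) currency: **`s_N22_rRec₁₁_of_s_N18`** — if node U3's objects of the reading are, at every admissible tuple with provisos, a TOWER reading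
  `t.objects ℓ` (`Node00.U3Tower₁₁.objects`) whose level functionals have (P) prefix dependence on `]0, θ.γ]` and the second-difference letter
  `M·μ^{age−1}·e^{−κd}·d²` at EVERY level, with `0 ≤ C₅`, `0 ≤ θ₅ < 1`, `0 < ρ ≤ 1`, `θ₅ ≤ ωρ`, `μρ ≤ ω`, `0 < ω` and the letter equation
  `ℓ.C₉ = (4·(2C₅∕(1−θ₅))∕θ.γ + M·θ.γ∕2)∕ω`, then `S_N18 (RRec₁₁ 𝔯) → S_N22 (RRec₁₁ 𝔯)` — node N18's stub supplies the oscillation input at every LOWER run length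
  (`RRec₁₁.other_level`: the lower levels are bundles of record at the same datum), p452282's `s_N22_of_s_N18_towerKeyed` does the rest.
* §3 the same edge in the (A′) derivative-letter and (A) sup-letter currencies (`…_strip`, `…_analytic`), letter equations
  `ℓ.ω = θ₅^{1−s}μ^{s}`, `ℓ.C₉ = (32∕(s²·min(r∕2, θ.γ∕2)))·(2C₅∕(1−θ₅))^{1−s}(2Lr)^{s}∕ω` resp. `…(2M)^{s}∕ω`.
HONEST FRAMING.  Count-neutral kernel bookkeeping BY NAME; the regularity letter ((R₂)∕(A′)∕(A), localized per domain with `e^{−κd}` — the object W1 + the un-printed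
history estimate) and the tower reading of `𝔯` are DISPLAYED hypotheses; the reading `𝔯` is RESIDUAL (layer B's honest framing applies verbatim: a skeleton quoting
`S_N22 (RRec₁₁ 𝔯)` NAMES its `𝔯`); NE5 ∕ NE9 NOT IN PRINT ([Balaban1987RG1] p. 263: *«It is a C^∞-function of g_{j−1} ∈ [0, γ], (or analytic)»*) and NOT PROVED; no node
discharged; one finite four-torus programme at fixed ε — NOT infinite volume, NOT OS on ℝ⁴, NOT a mass gap, NOT Clay.  0 `sorry`, 0 `def`, standard axioms.
-/

noncomputable section

namespace YMDAG.N22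

open Set Metric
open scoped BigOperators
open Literature.MathematicalPhysics.QuantumFieldTheory.Balaban1983to89
open Literature.MathematicalPhysics.QuantumFieldTheory.Balaban1983to89.T4Continuum
open Literature.MathematicalPhysics.QuantumFieldTheory.Balaban1983to89.T4OutputRate
open Literature.MathematicalPhysics.QuantumFieldTheory.Balaban1983to89.Node00
  (Stage11Params datumOfRecord₁₁ IsDatumOfRecord₁₁C U3Letters₁₁ U3Objects₁₁ U3Tower₁₁)
open Summit.QuantumFields.BalabanUV.T4Continuum.NE9.TowerCarriers (TowerData prepend)
open YMDAG.UVSplit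

variable {N : ℕ} [NeZero N] (𝔯 : RateReading₁₁ N)

/-! ## §1 N22's stub at the home is «NE9 at every level» under the letter signs -/

/-- **N22 AT THE HOME FROM NE9 ALONE (θ-form).**  If the reading's letter block carries its displayed signs and, at EVERY admissible Stage-11 tuple with provisos,
every `(g₀, os)` and every run length `k`, the level functional `(𝔯.lit F θ g₀ os).u3.EA k` has the joint history-Lipschitz bound NE9 on `]0, θ.γ]` with the moduli OF
RECORD `C₉·ω^{k−i}`, then `S_N22 (RRec₁₁ 𝔯)` — fading memory is the letter block's shape (`fadingMemory_u3OfRecord₁₁`). [folklore] -/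
theorem s_N22_rRec₁₁_of_ne9
    (hs : ∀ (F : T4Family) (θ : Stage11Params F N), θ.Provisos₁₁ → θ.Admissible → ∀ (g₀ : ℕ → ℝ) (os : List (ULoop F)),
      (𝔯.lit F θ g₀ os).u3.Signs)
    (h9 : ∀ (F : T4Family) (θ : Stage11Params F N), θ.Provisos₁₁ → θ.Admissible → ∀ (g₀ : ℕ → ℝ) (os : List (ULoop F)) (k : ℕ),
      NE9 ((𝔯.lit F θ g₀ os).u3.EA k) (Window θ.γ) (𝔯.lit F θ g₀ os).u3.κ (𝔯.lit F θ g₀ os).u3.moduli) :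
    S_N22 (RRec₁₁ 𝔯) := by
  rw [s_N22_rRec₁₁_iff]
  intro F D h g₀ os k
  exact (n22At_u3OfRecord₁₁_iff h.params _ k (hs F h.params h.provisos h.admissible g₀ os)).mpr
    (h9 F h.params h.provisos h.admissible g₀ os k)

/-! ## §2 The edge N18 → N22 at the home, second-difference currency (R₂) -/

/-- **`S_N18 (RRec₁₁ 𝔯) → S_N22 (RRec₁₁ 𝔯)` FOR A TOWER READING WITH (P) + (R₂) AT EVERY LEVEL.**  Hypotheses (displayed): at every admissible Stage-11 tuple with
provisos and every `(g₀, os)`, node U3's objects of the reading ARE a tower reading `t.objects ℓ` with `0 ≤ ℓ.C₅`, `0 ≤ ℓ.θ₅ < 1`, every level functional `t.E k` has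
(P) prefix dependence on `]0, θ.γ]` and second differences of its young-coupling sections bounded by `M·μ^{age−1}·e^{−ℓ.κ·d}·d²`, and `0 ≤ M`, `0 ≤ μ`, `0 < ρ ≤ 1`,
`ℓ.θ₅ ≤ ℓ.ω·ρ`, `μρ ≤ ℓ.ω`, `0 < ℓ.ω`, `ℓ.C₉ = (4·(2ℓ.C₅∕(1−ℓ.θ₅))∕θ.γ + M·θ.γ∕2)∕ℓ.ω` (the home DEFINES `C₉` by this formula).  Then node N18's stub at the home
gives node N22's: every lower run length is a bundle of record at the same datum (`RRec₁₁.other_level`), so p452282's `s_N22_of_s_N18_towerKeyed` applies with the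
bundle literal `u3OfRecord₁₁_objects`. [folklore] -/
theorem s_N22_rRec₁₁_of_s_N18 (h18 : S_N18 (RRec₁₁ 𝔯))
    (htow : ∀ (F : T4Family) (θ : Stage11Params F N), θ.Provisos₁₁ → θ.Admissible → ∀ (g₀ : ℕ → ℝ) (os : List (ULoop F)),
      ∃ (t : U3Tower₁₁) (ℓ : U3Letters₁₁) (M μ ρ : ℝ), (𝔯.lit F θ g₀ os).u3 = t.objects ℓ ∧ 0 ≤ ℓ.C₅ ∧ 0 ≤ ℓ.θ₅ ∧ ℓ.θ₅ < 1 ∧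
        (∀ k : ℕ, PrefixDependenceOn (C := (towerData₁₁ t).level k) (t.E k) (Window θ.γ)) ∧
        (∀ k : ℕ, ∀ g ∈ Window θ.γ, ∀ (U : ((towerData₁₁ t).level k).BgA) (X : ((towerData₁₁ t).level k).Dom) (i : ℕ),
          i < ((towerData₁₁ t).level k).scale X → ∀ a d : ℝ, 0 < d → a - d ∈ Ioc (0 : ℝ) θ.γ → a + d ∈ Ioc (0 : ℝ) θ.γ →
            |t.E k (Function.update g i (a + d)) U X - 2 * t.E k (Function.update g i a) U X + t.E k (Function.update g i (a - d)) U X| ≤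
              M * μ ^ (((towerData₁₁ t).level k).scale X - 1 - i) * Real.exp (-(ℓ.κ * ((towerData₁₁ t).level k).d X)) * d ^ 2) ∧
        0 ≤ M ∧ 0 ≤ μ ∧ 0 < ρ ∧ ρ ≤ 1 ∧ ℓ.θ₅ ≤ ℓ.ω * ρ ∧ μ * ρ ≤ ℓ.ω ∧ 0 < ℓ.ω ∧
        ℓ.C₉ = (4 * (2 * ℓ.C₅ / (1 - ℓ.θ₅)) / θ.γ + M * θ.γ / 2) / ℓ.ω) :
    S_N22 (RRec₁₁ 𝔯) := by
  refine s_N22_of_s_N18_towerKeyed (RRec₁₁ 𝔯) h18 ?_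
  rintro F D g₀ os R ⟨h, k, rfl⟩
  obtain ⟨t, ℓ, M, μ, ρ, hu, hC, hθ0, hθ1, hP, hR2, hM, hμ, hρ0, hρ1, hθτρ, hμρτ, hτ0, hC₉⟩ :=
    htow F h.params h.provisos h.admissible g₀ os
  refine ⟨towerData₁₁ t, t.E, h.params.γ, ℓ.κ, ℓ.θ₅, ℓ.C₅, M, μ, ρ, ℓ.ω, ℓ.cr, ℓ.ρ, k, ?_, hC, hθ0, hθ1, ?_, hP k, hR2 k, hM, hμ,
    h.gamma_pos, hρ0, hρ1, hθτρ, hμρτ, hτ0⟩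
  · show u3OfRecord₁₁ h.params (𝔯.lit F h.params g₀ os).u3 k = _
    rw [hu, u3OfRecord₁₁_objects, ← hC₉]
  · intro k' _
    refine ⟨rateCarriersOfRecord₁₁ 𝔯 F h.params g₀ os k', fun a i => ℓ.C₉ * ℓ.ω ^ (a - i), ℓ.C₉, ℓ.ω, ℓ.cr, ℓ.ρ, ⟨h, k', rfl⟩, ?_⟩
    show u3OfRecord₁₁ h.params (𝔯.lit F h.params g₀ os).u3 k' = _
    rw [hu, u3OfRecord₁₁_objects]

/-! ## §3 The edge at the home in the (A′) derivative-letter and (A) sup-letter currencies -/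

/-- **`S_N18 (RRec₁₁ 𝔯) → S_N22 (RRec₁₁ 𝔯)` FOR A TOWER READING WITH (P) + (A′) AT EVERY LEVEL** (ROAD 3 in the strip ∕ derivative-letter currency): as §2 with
`0 < ℓ.C₅`, `0 < ℓ.θ₅ < 1`, ONE complex-differentiable extension per young-coupling section of `t.E k` on a set containing the open `r`-discs about `]0, θ.γ]` with the
derivative letter `L·μ^{age−1}·e^{−ℓ.κ·d}` (`0 < L`, `ℓ.θ₅ ≤ μ`, `2ℓ.C₅∕(1−ℓ.θ₅) ≤ 2Lr`, `0 < r`, `0 < s < 1`), and the letter equations `ℓ.ω = ℓ.θ₅^{1−s}μ^{s}`,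
`ℓ.C₉ = (32∕(s²·min(r∕2, θ.γ∕2)))·(2ℓ.C₅∕(1−ℓ.θ₅))^{1−s}(2(Lr))^{s}∕(ℓ.θ₅^{1−s}μ^{s})` — via p452282's `s_N22_of_s_N18_towerKeyed_strip`. [folklore] -/
theorem s_N22_rRec₁₁_of_s_N18_strip (h18 : S_N18 (RRec₁₁ 𝔯))
    (htow : ∀ (F : T4Family) (θ : Stage11Params F N), θ.Provisos₁₁ → θ.Admissible → ∀ (g₀ : ℕ → ℝ) (os : List (ULoop F)),
      ∃ (t : U3Tower₁₁) (ℓ : U3Letters₁₁) (L μ r s : ℝ), (𝔯.lit F θ g₀ os).u3 = t.objects ℓ ∧ 0 < ℓ.C₅ ∧ 0 < ℓ.θ₅ ∧ ℓ.θ₅ < 1 ∧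
        (∀ k : ℕ, PrefixDependenceOn (C := (towerData₁₁ t).level k) (t.E k) (Window θ.γ)) ∧
        (∀ k : ℕ, ∀ g ∈ Window θ.γ, ∀ (U : ((towerData₁₁ t).level k).BgA) (X : ((towerData₁₁ t).level k).Dom) (i : ℕ),
          i < ((towerData₁₁ t).level k).scale X → ∃ (Fz : ℂ → ℂ) (Dset : Set ℂ), DifferentiableOn ℂ Fz Dset ∧
            (∀ z ∈ Dset, ‖deriv Fz z‖ ≤ L * μ ^ (((towerData₁₁ t).level k).scale X - 1 - i) * Real.exp (-(ℓ.κ * ((towerData₁₁ t).level k).d X))) ∧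
            (∀ a ∈ Ioc (0 : ℝ) θ.γ, ball (a : ℂ) r ⊆ Dset) ∧ (∀ a ∈ Ioc (0 : ℝ) θ.γ, Fz a = (t.E k (Function.update g i a) U X : ℂ))) ∧
        0 < L ∧ ℓ.θ₅ ≤ μ ∧ 2 * ℓ.C₅ / (1 - ℓ.θ₅) ≤ 2 * (L * r) ∧ 0 < r ∧ 0 < s ∧ s < 1 ∧
        ℓ.ω = ℓ.θ₅ ^ (1 - s) * μ ^ s ∧
        ℓ.C₉ = 32 / (s ^ 2 * min (r / 2) (θ.γ / 2)) * ((2 * ℓ.C₅ / (1 - ℓ.θ₅)) ^ (1 - s) * (2 * (L * r)) ^ s) / (ℓ.θ₅ ^ (1 - s) * μ ^ s)) :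
    S_N22 (RRec₁₁ 𝔯) := by
  refine s_N22_of_s_N18_towerKeyed_strip (RRec₁₁ 𝔯) h18 ?_
  rintro F D g₀ os R ⟨h, k, rfl⟩
  obtain ⟨t, ℓ, L, μ, r, s, hu, hC, hθ0, hθ1, hP, hA, hL, hθμ, hCL, hr, hs0, hs1, hω, hC₉⟩ :=
    htow F h.params h.provisos h.admissible g₀ os
  refine ⟨towerData₁₁ t, t.E, h.params.γ, ℓ.κ, ℓ.θ₅, ℓ.C₅, L, μ, r, s, ℓ.cr, ℓ.ρ, k, ?_, hC, hθ0, hθ1, ?_, hP k, hA k, hL, hθμ, hCL, hr,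
    h.gamma_pos, hs0, hs1⟩
  · show u3OfRecord₁₁ h.params (𝔯.lit F h.params g₀ os).u3 k = _
    rw [hu, u3OfRecord₁₁_objects, ← hC₉, ← hω]
  · intro k' _
    refine ⟨rateCarriersOfRecord₁₁ 𝔯 F h.params g₀ os k', fun a i => ℓ.C₉ * ℓ.ω ^ (a - i), ℓ.C₉, ℓ.ω, ℓ.cr, ℓ.ρ, ⟨h, k', rfl⟩, ?_⟩
    show u3OfRecord₁₁ h.params (𝔯.lit F h.params g₀ os).u3 k' = _
    rw [hu, u3OfRecord₁₁_objects]

/-- **`S_N18 (RRec₁₁ 𝔯) → S_N22 (RRec₁₁ 𝔯)` FOR A TOWER READING WITH (P) + (A) AT EVERY LEVEL** (ROAD 3, sup-letter currency — printed TYPE «(or analytic)»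
[Balaban1987RG1] p. 263 for the last coupling): a complex-differentiable extension of every young-coupling section of `t.E k` on a set containing the CLOSED `r`-discs
about `]0, θ.γ]` with the sup letter `M·μ^{age−1}·e^{−ℓ.κ·d}` (`0 < M`, `ℓ.θ₅ ≤ μ`, `2ℓ.C₅∕(1−ℓ.θ₅) ≤ 2M`, `0 < r`, `0 < s < 1`), letter equations
`ℓ.ω = ℓ.θ₅^{1−s}μ^{s}`, `ℓ.C₉ = (32∕(s²·min(r∕2, θ.γ∕2)))·(2ℓ.C₅∕(1−ℓ.θ₅))^{1−s}(2M)^{s}∕(ℓ.θ₅^{1−s}μ^{s})` — via p452282's `s_N22_of_s_N18_towerKeyed_analytic`. [folklore] -/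
theorem s_N22_rRec₁₁_of_s_N18_analytic (h18 : S_N18 (RRec₁₁ 𝔯))
    (htow : ∀ (F : T4Family) (θ : Stage11Params F N), θ.Provisos₁₁ → θ.Admissible → ∀ (g₀ : ℕ → ℝ) (os : List (ULoop F)),
      ∃ (t : U3Tower₁₁) (ℓ : U3Letters₁₁) (M μ r s : ℝ), (𝔯.lit F θ g₀ os).u3 = t.objects ℓ ∧ 0 < ℓ.C₅ ∧ 0 < ℓ.θ₅ ∧ ℓ.θ₅ < 1 ∧
        (∀ k : ℕ, PrefixDependenceOn (C := (towerData₁₁ t).level k) (t.E k) (Window θ.γ)) ∧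
        (∀ k : ℕ, ∀ g ∈ Window θ.γ, ∀ (U : ((towerData₁₁ t).level k).BgA) (X : ((towerData₁₁ t).level k).Dom) (i : ℕ),
          i < ((towerData₁₁ t).level k).scale X → ∃ (Fz : ℂ → ℂ) (Dset : Set ℂ), DifferentiableOn ℂ Fz Dset ∧
            (∀ z ∈ Dset, ‖Fz z‖ ≤ M * μ ^ (((towerData₁₁ t).level k).scale X - 1 - i) * Real.exp (-(ℓ.κ * ((towerData₁₁ t).level k).d X))) ∧
            (∀ a ∈ Ioc (0 : ℝ) θ.γ, closedBall (a : ℂ) r ⊆ Dset) ∧ (∀ a ∈ Ioc (0 : ℝ) θ.γ, Fz a = (t.E k (Function.update g i a) U X : ℂ))) ∧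
        0 < M ∧ ℓ.θ₅ ≤ μ ∧ 2 * ℓ.C₅ / (1 - ℓ.θ₅) ≤ 2 * M ∧ 0 < r ∧ 0 < s ∧ s < 1 ∧
        ℓ.ω = ℓ.θ₅ ^ (1 - s) * μ ^ s ∧
        ℓ.C₉ = 32 / (s ^ 2 * min (r / 2) (θ.γ / 2)) * ((2 * ℓ.C₅ / (1 - ℓ.θ₅)) ^ (1 - s) * (2 * M) ^ s) / (ℓ.θ₅ ^ (1 - s) * μ ^ s)) :
    S_N22 (RRec₁₁ 𝔯) := by
  refine s_N22_of_s_N18_towerKeyed_analytic (RRec₁₁ 𝔯) h18 ?_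
  rintro F D g₀ os R ⟨h, k, rfl⟩
  obtain ⟨t, ℓ, M, μ, r, s, hu, hC, hθ0, hθ1, hP, hA, hM, hθμ, hCM, hr, hs0, hs1, hω, hC₉⟩ :=
    htow F h.params h.provisos h.admissible g₀ os
  refine ⟨towerData₁₁ t, t.E, h.params.γ, ℓ.κ, ℓ.θ₅, ℓ.C₅, M, μ, r, s, ℓ.cr, ℓ.ρ, k, ?_, hC, hθ0, hθ1, ?_, hP k, hA k, hM, hθμ, hCM, hr,
    h.gamma_pos, hs0, hs1⟩
  · show u3OfRecord₁₁ h.params (𝔯.lit F h.params g₀ os).u3 k = _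
    rw [hu, u3OfRecord₁₁_objects, ← hC₉, ← hω]
  · intro k' _
    refine ⟨rateCarriersOfRecord₁₁ 𝔯 F h.params g₀ os k', fun a i => ℓ.C₉ * ℓ.ω ^ (a - i), ℓ.C₉, ℓ.ω, ℓ.cr, ℓ.ρ, ⟨h, k', rfl⟩, ?_⟩
    show u3OfRecord₁₁ h.params (𝔯.lit F h.params g₀ os).u3 k' = _
    rw [hu, u3OfRecord₁₁_objects]

/-! ## §4 K4's hook at the per-level home is the ∀-PACKAGING `RateInputsAll (RRec₁₁ 𝔯)` — rates at EVERY run length (what N19′ needs); the join by name -/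

/-- **WHAT N19′ UNPACKS AT THE HOME**: `RateInputsAll (RRec₁₁ 𝔯) F D g₀ os` IS «at every datum key of `D`, the six in-edges of N19 hold at EVERY run length `k` of the
reading's bundles» — the rates along the WHOLE tower, not at one level (the single-bundle hook `RateInputs (RRec₁₁ 𝔯)` = `rateInputs_rRec₁₁_iff` reads ONE run length and is
NOT the shape the K4 → K5 junction wants at a per-level home). [folklore] -/
theorem rateInputsAll_rRec₁₁_iff {F : T4Family} (D : Datum F N) (g₀ : ℕ → ℝ) (os : List (ULoop F)) :
    RateInputsAll (RRec₁₁ 𝔯) F D g₀ os ↔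
      ∀ (h : IsDatumOfRecord₁₁C F N D) (k : ℕ), RatesAt D (rateCarriersOfRecord₁₁ 𝔯 F h.params g₀ os k) := by
  constructor
  · intro hall h k
    exact hall _ ⟨h, k, rfl⟩
  · rintro hall R ⟨h, k, rfl⟩
    exact hall h k

/-- **K4's CONCLUSION HOOK AT THE HOME, ∀-PACKAGED, FROM THE SIX STUBS** (the route's `YMDAG.UVSplit.SpineRates_of_forall` at `RRec := RRec₁₁ 𝔯`, any record predicate `Rec`):
`SpineRates Rec (RateInputsAll (RRec₁₁ 𝔯))` — K5's N19 stub then reads `S_N19 SRec (RateInputsAll (RRec₁₁ 𝔯))`, i.e. the rates at every run length. [folklore] -/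
theorem spineRates_rRec₁₁_of_forall (Rec : RecordPred N) (h14 : S_N14 (RRec₁₁ 𝔯)) (h15 : S_N15 (RRec₁₁ 𝔯)) (h16 : S_N16 (RRec₁₁ 𝔯))
    (h17 : S_N17 (RRec₁₁ 𝔯)) (h18 : S_N18 (RRec₁₁ 𝔯)) (h22 : S_N22 (RRec₁₁ 𝔯)) : SpineRates Rec (RateInputsAll (RRec₁₁ 𝔯)) :=
  SpineRates_of_forall Rec (RRec₁₁ 𝔯) h14 h15 h16 h17 h18 h22

/-- **… WITH N17 GLUED AND N22 DERIVED FROM N18 ON A TOWER READING** — the home's K4 hook from FIVE stubs (N14, N15, N16, N18, D4) plus N22's regularity letter (§2's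
hypotheses): `N17_of_U3edge` glues N17, `s_N22_rRec₁₁_of_s_N18` derives N22. [folklore] -/
theorem spineRates_rRec₁₁_of_towerReading (Rec : RecordPred N) (h14 : S_N14 (RRec₁₁ 𝔯)) (h15 : S_N15 (RRec₁₁ 𝔯)) (h16 : S_N16 (RRec₁₁ 𝔯))
    (h18 : S_N18 (RRec₁₁ 𝔯)) (hD4 : S_D4 (RRec₁₁ 𝔯))
    (htow : ∀ (F : T4Family) (θ : Stage11Params F N), θ.Provisos₁₁ → θ.Admissible → ∀ (g₀ : ℕ → ℝ) (os : List (ULoop F)),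
      ∃ (t : U3Tower₁₁) (ℓ : U3Letters₁₁) (M μ ρ : ℝ), (𝔯.lit F θ g₀ os).u3 = t.objects ℓ ∧ 0 ≤ ℓ.C₅ ∧ 0 ≤ ℓ.θ₅ ∧ ℓ.θ₅ < 1 ∧
        (∀ k : ℕ, PrefixDependenceOn (C := (towerData₁₁ t).level k) (t.E k) (Window θ.γ)) ∧
        (∀ k : ℕ, ∀ g ∈ Window θ.γ, ∀ (U : ((towerData₁₁ t).level k).BgA) (X : ((towerData₁₁ t).level k).Dom) (i : ℕ),
          i < ((towerData₁₁ t).level k).scale X → ∀ a d : ℝ, 0 < d → a - d ∈ Ioc (0 : ℝ) θ.γ → a + d ∈ Ioc (0 : ℝ) θ.γ →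
            |t.E k (Function.update g i (a + d)) U X - 2 * t.E k (Function.update g i a) U X + t.E k (Function.update g i (a - d)) U X| ≤
              M * μ ^ (((towerData₁₁ t).level k).scale X - 1 - i) * Real.exp (-(ℓ.κ * ((towerData₁₁ t).level k).d X)) * d ^ 2) ∧
        0 ≤ M ∧ 0 ≤ μ ∧ 0 < ρ ∧ ρ ≤ 1 ∧ ℓ.θ₅ ≤ ℓ.ω * ρ ∧ μ * ρ ≤ ℓ.ω ∧ 0 < ℓ.ω ∧
        ℓ.C₉ = (4 * (2 * ℓ.C₅ / (1 - ℓ.θ₅)) / θ.γ + M * θ.γ / 2) / ℓ.ω) :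
    SpineRates Rec (RateInputsAll (RRec₁₁ 𝔯)) :=
  have h22 : S_N22 (RRec₁₁ 𝔯) := s_N22_rRec₁₁_of_s_N18 𝔯 h18 htow
  SpineRates_of_forall Rec (RRec₁₁ 𝔯) h14 h15 h16 (N17_of_U3edge (RRec₁₁ 𝔯) hD4 h18 h22) h18 h22

end YMDAG.N22

end
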